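import Mathlib.Analysis.Calculus.FDeriv.Analytic
import Mathlib.Analysis.InnerProductSpace.PiL2
import HarnessLib

/-!
# Stub J1 `stub_eventuallyEq_zero_of_jet` for crux `MoebiusLimitExists` (stmt-CriticalPhenomena-1344), line `Sketch` v16
(lead prover-line-stmt-CriticalPhenomena-1344-c19-0; THEOREM-ONLY, `--supports stmt-CriticalPhenomena-1344`)

**A real-analytic function with vanishing Taylor jet at a point vanishes near that point.** For the
Ward-defect function `D : (ℝ³)ⁿ → ℝ` of skeleton v16: if `D` is analytic at `x₀` and all iterated Fréchet
derivatives `iteratedFDeriv ℝ k D x₀` vanish, then `D = 0` on a neighbourhood of `x₀`.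

Proof. Unfold `AnalyticAt` to a power series `p` with `HasFPowerSeriesOnBall D p x₀ r`, `0 < r`. Mathlib's
`HasFPowerSeriesOnBall.hasSum_iteratedFDeriv` gives, for `y ∈ eball 0 r`,
`D (x₀ + y) = ∑ₖ (k!)⁻¹ • iteratedFDeriv ℝ k D x₀ (y, …, y)`; every summand is `0`, so `D` vanishes on the
ball `eball x₀ r`, which is a neighbourhood of `x₀`.

References: standard (identity theorem for analytic functions, local form). No definitions are introduced.
-/

open scoped Topology

namespace Summit.CriticalPhenomena.Ising3DConformalLimit.MoebiusLimitExistsSketchV16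

/-- **Stub J1 — `stub_eventuallyEq_zero_of_jet`** (registered signature). An analytic function
`D : (ℝ³)ⁿ → ℝ` all of whose iterated Fréchet derivatives vanish at `x₀` vanishes on a neighbourhood of `x₀`
(Taylor expansion on the ball of convergence: `HasFPowerSeriesOnBall.hasSum_iteratedFDeriv`, all summands
are zero). [folklore] -/
theorem stub_eventuallyEq_zero_of_jet : ∀ (n : ℕ) (D : (Fin n → EuclideanSpace ℝ (Fin 3)) → ℝ)
    (x₀ : Fin n → EuclideanSpace ℝ (Fin 3)), AnalyticAt ℝ D x₀ → (∀ k : ℕ, iteratedFDeriv ℝ k D x₀ = 0) →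
    D =ᶠ[𝓝 x₀] 0 := by
  intro n D x₀ hD hjet
  obtain ⟨p, r, hp⟩ := hD
  have hball : ∀ z ∈ Metric.eball x₀ r, D z = 0 := by
    intro z hz
    have hy : z - x₀ ∈ Metric.eball (0 : Fin n → EuclideanSpace ℝ (Fin 3)) r := by
      rw [Metric.mem_eball, edist_eq_enorm_sub] at hz ⊢
      simpa using hz
    have hs := hp.hasSum_iteratedFDeriv hy
    simp only [hjet, zero_apply, smul_zero] at hs
    rw [add_sub_cancel] at hs
    exact hs.unique hasSum_zero
  filter_upwards [Metric.isOpen_eball.mem_nhds (Metric.mem_eball_self hp.r_pos)] with z hz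
  exact hball z hz

end Summit.CriticalPhenomena.Ising3DConformalLimit.MoebiusLimitExistsSketchV16
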